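import Literature.AnabelianGeometry.EtaleTheta.ContH1
import HarnessLib

/-!
# Continuous `H¹`: inner automorphisms act trivially (support lemma for [EtTh] §1)

[EtTh] §1 lets the quotient `Z ≅ Π^tp_X/Π^tp_Y` — not `Π^tp_X` itself — act on classes in
`H¹((Π^tp_Ÿ)^Θ, Δ_Θ)` (Prop. 1.5 (iii), PRIMS PDF p. 23) and speaks of "the `Π^tp_Ẋ/Π^tp_Ÿ ≅ Z`-orbit of
`η̈^Θ`" (Def. 1.9, p. 29) [cite: MochizukiEtTh2009, Prop 1.5 (iii) p.23]. This is meaningful because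
conjugation by an element of the subgroup `H` itself acts TRIVIALLY on `H¹(H, A)`: the conjugate of a
cocycle `f` by `σ ∈ H` differs from `f` by the coboundary of `f(σ)`. This file PROVES that classical fact
([cite: NeukirchSchmidtWingberg2008, I §5]) for the concrete `ContH1` of `ContH1.lean`
(`ContH1.conj_eq_self_of_mem`), so the `Z`-actions typed in `ThetaCohomology.lean` /
`ConstantMultipleRigidity.lean` factor through the printed quotients. Seat abc-iut-L2-t1.
-/

namespace Literature.AnabelianGeometry.EtaleTheta

namespace ContH1

variable {G G' : Type*} [Group G] [TopologicalSpace G] [IsTopologicalGroup G]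
  [Group G'] [TopologicalSpace G'] [IsTopologicalGroup G']
  {φ : G →* G'} {A : Subgroup G'} [A.Normal] [IsMulCommutative A] {H : Subgroup G}

omit [IsTopologicalGroup G] in
/-- A cocycle vanishes at the identity: `f(1) = 1`. [cite: NeukirchSchmidtWingberg2008, I §5] -/
theorem cocycle_map_one (f : contCocycles φ A H) : f.1 1 = 1 := by
  have h := f.2.2 1 1
  simp only [mul_one, OneMemClass.coe_one, map_one, MulAut.one_apply] at h
  exact (mul_left_cancel (a := f.1 1) (by rw [mul_one]; exact h.symm))

omit [IsTopologicalGroup G] in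
/-- For a cocycle `f` and `σ ∈ H`: `φ(σ) f(σ⁻¹) φ(σ)⁻¹ = f(σ)⁻¹` (from `f(σ⁻¹ σ) = f(1) = 1`).
[cite: NeukirchSchmidtWingberg2008, I §5] -/
theorem conjNormal_apply_map_inv (f : contCocycles φ A H) (σ : H) :
    MulAut.conjNormal (φ (σ : G)) (f.1 σ⁻¹) = (f.1 σ)⁻¹ := by
  have h2 := f.2.2 σ⁻¹ σ
  rw [inv_mul_cancel, cocycle_map_one] at h2
  have h3 : f.1 σ⁻¹ = (MulAut.conjNormal (φ ((σ⁻¹ : H) : G)) (f.1 σ))⁻¹ :=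
    eq_inv_of_mul_eq_one_left h2.symm
  rw [h3, map_inv, ← MulAut.mul_apply, ← map_mul, Subgroup.coe_inv, map_inv, mul_inv_cancel,
    map_one, MulAut.one_apply]

omit [IsTopologicalGroup G] in
/-- **Restriction is functorial**: restricting along `H₁ ≤ H₂ ≤ H₃` in two steps or one gives the same
class (so the kernels `F² ⊆ F¹` of [EtTh] Prop. 1.5 are nested). [cite: NeukirchSchmidtWingberg2008, I §5] -/
theorem res_res {H₁ H₂ H₃ : Subgroup G} (h₁₂ : H₁ ≤ H₂) (h₂₃ : H₂ ≤ H₃) (x : ContH1 φ A H₃) :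
    res φ A h₁₂ (res φ A h₂₃ x) = res φ A (h₁₂.trans h₂₃) x := by
  induction x using QuotientGroup.induction_on with
  | H f => rfl

variable [H.Normal]

/-- The conjugate cocycle, evaluated: `(σ·f)(h) = f(σ)⁻¹ · f(h) · (φ(h) f(σ) φ(h)⁻¹)` for `σ ∈ H`.
[cite: NeukirchSchmidtWingberg2008, I §5] -/
theorem conjCocycle_apply_of_mem (f : contCocycles φ A H) (σ : G) (hσ : σ ∈ H) (h : H) :
    (conjCocycle φ A σ f).1 h =
      (f.1 ⟨σ, hσ⟩)⁻¹ * (f.1 h * MulAut.conjNormal (φ (h : G)) (f.1 ⟨σ, hσ⟩)) := by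
  have e : MulAut.conjNormal σ⁻¹ h = (⟨σ, hσ⟩⁻¹ : H) * (h * ⟨σ, hσ⟩) := by
    apply Subtype.ext
    simp only [MulAut.conjNormal_apply, inv_inv, Subgroup.coe_mul, Subgroup.coe_inv, mul_assoc]
  change MulAut.conjNormal (φ σ) (f.1 (MulAut.conjNormal σ⁻¹ h)) = _
  rw [e, f.2.2, f.2.2, map_mul, ← conjNormal_apply_map_inv f ⟨σ, hσ⟩, ← MulAut.mul_apply,
    ← map_mul, Subgroup.coe_inv, ← map_mul, mul_inv_cancel, map_one, map_one, MulAut.one_apply]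

/-- **Inner automorphisms act trivially on `H¹`**: for `σ ∈ H`, conjugation by `σ` is the identity on
`H¹(H, A)` — the conjugate cocycle equals `f · ∂(f(σ))`. Hence the action of `G` on `H¹(H, A)`
(`ContH1.conj`) factors through `G/H` ([EtTh]: `Z ≅ Π^tp_X/Π^tp_Y`, Prop. 1.5 (iii), Def. 1.9).
[cite: NeukirchSchmidtWingberg2008, I §5] -/
theorem conj_eq_self_of_mem (σ : G) (hσ : σ ∈ H) (x : ContH1 φ A H) :
    conj φ A σ x = x := by
  induction x using QuotientGroup.induction_on with
  | H f =>
    symm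
    change (QuotientGroup.mk f : ContH1 φ A H) = QuotientGroup.mk (conjCocycle φ A σ f)
    rw [QuotientGroup.eq, Subgroup.mem_subgroupOf, mem_contCoboundaries_iff]
    refine ⟨f.1 ⟨σ, hσ⟩, ?_⟩
    funext h
    change (f.1 h)⁻¹ * (conjCocycle φ A σ f).1 h = _
    rw [conjCocycle_apply_of_mem f σ hσ h, mul_comm' ((f.1 ⟨σ, hσ⟩)⁻¹) _, ← mul_assoc,
      inv_mul_cancel_left]

end ContH1

end Literature.AnabelianGeometry.EtaleTheta
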